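import Summits.NavierStokesRegularity.FluidComputer.PalasekTowerRegisterGlobalHalves
import Summits.NavierStokesRegularity.FluidComputer.PalasekTowerHeredityWitness
import Literature.Analysis.FluidPDE.LerayHopfClassicalContinuationApriori
import Literature.Analysis.FluidPDE.LerayHopfConcatenation

/-!
# REGISTER v2.3′: the upper half `ContinuationEnvelope` holds as soon as continuations cannot
# overshoot — existence up to the next readout is a theorem (a-priori continuation of a stage)

Cell `ns-blowup`, seat `ns-blowup-ecbridge-5` (g2); companion of
`PalasekTowerRegisterGlobalHeredity.lean` (p415576: the named halves `ContinuationEnvelope` /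
`ReadoutFloors` of the crux `EpisodeInductionG` at the generic levels, items
stmt-NavierStokesRegularity-19178 / -19250) and of `PalasekTowerRegisterGlobalHalves.lean`
(p419350: silent-window uniqueness, `Stage.continuation_velocity_eq`). LABEL: E–C typing (KERNEL
theorems; no `Prop` is introduced here). WHAT THIS IS NOT: not Navier–Stokes evidence — no stage,
tower or instance is constructed or claimed; nothing here asserts regularity or blow-up.

## What is proved

The upper half `ContinuationEnvelope` asks, for every registered stage `s` at a level `k ≥ 2` of a
quiet schedule, for a finite-energy classical continuation to the next readout `τ (k+1)` inside
the next ceiling `c₂ Y_{k+1}` — an EXISTENCE statement ("no premature blow-up") and a BOUND ("no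
overshoot"). This file proves that the existence part is free given the bound a priori:

* §1 `exists_isGlobalLerayHopf_extension_Icc` — global Leray–Hopf extension, agreement on `[0, T]`.
* §2 `Stage.exists_continuation_of_rep` — gluing: a classical representative `(V, P)` (unforced,
  time origin `τ 1`) of a Leray–Hopf field issued from `s.u (τ 1)`, agreeing with the stage on
  `[0, τ k - τ 1)`, yields on every `[0, T']` it covers a classical continuation of the stage
  (schedule's silent force; velocity AND pressure agree on `[0, τ k]`, the pressure re-gauged by
  a smooth function of time; finite energy carried by the Leray–Hopf field).
* §3 `Stage.exists_continuation_of_apriori` — **a-priori continuation of a stage** (any rates,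
  margins, `ν > 0`; quiet schedule, `k ≥ 2`): if every finite-energy classical continuation of `s`
  on any `[0, T'] ⊆ [0, T₁]` is bounded by some `M` on `[τ k, T']`, then `s` HAS a finite-energy
  classical continuation on `[0, T₁]`. After `τ 1` the force is silent, so `s.u (· + τ 1)` is an
  unforced finite-energy classical solution, hence Leray–Hopf (Tao 2013, Lemma 8.1,
  `isLerayHopfOn_of_finiteEnergy`), extended to a global Leray–Hopf field `W` (Leray 1934); the
  a-priori continuation theorem for bounded classical representatives of `W`
  (`exists_classical_extension_of_apriori_bound`, RRS 2016 Thm. 8.17 iterated to a prescribed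
  time) applies because every candidate representative glues (§2) to a continuation of `s`.
* §4 `continuationEnvelope_of_apriori` / `apriori_of_continuationEnvelope` — `ContinuationEnvelope`
  is EQUIVALENT to the a-priori ceiling «every finite-energy classical continuation of a registered
  stage at `k ≥ 2` on any `[0, T'] ⊆ [0, τ (k+1)]` stays `≤ c₂ Y_{k+1}`» (⇒ by silent-window
  uniqueness `Stage.continuation_velocity_eq`): premature loss of smoothness or of finite energy
  before `τ (k+1)` is excluded by theorem; the residual content of the upper stub is no-overshoot.

References: J. C. Robinson, J. L. Rodrigo, W. Sadowski, *The Three-Dimensional Navier–Stokes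
Equations*, CUP 2016, Thm. 8.17 [cite: RobinsonRodrigoSadowski2016, Thm. 8.17]; T. Tao, Anal. PDE 6
(2013), Lemma 8.1, Cor. 11.4 [cite: Tao2011, Lemma 8.1]; J. Leray, Acta Math. 63 (1934) §§31–33
[cite: Leray1934, §33]; S. Palasek, arXiv:2605.13827 §4 [cite: Palasek2026ElementaryModel, §4].
-/

noncomputable section

namespace Summit.NavierStokesRegularity.FluidComputer.PalasekTowerClayBridge

open Set MeasureTheory Filter Topology Function Real
open scoped ENNReal ContDiff NNReal
open Literature.Analysis.FluidPDE

/-! ## §1 Global Leray–Hopf extension, agreement on the closed interval -/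

/-- **Global Leray–Hopf extension with agreement on `[0, T]`** (the tree's
`IsLerayHopfOn.exists_isGlobalLerayHopf_extension`, Leray 1934 §31, restated with the closed
interval: the glued field IS `u` at `t = 0` as well). [cite: Leray1934, §31] -/
theorem exists_isGlobalLerayHopf_extension_Icc {ν T : ℝ}
    {u₀ : EuclideanSpace ℝ (Fin 3) → EuclideanSpace ℝ (Fin 3)}
    {u : ℝ → EuclideanSpace ℝ (Fin 3) → EuclideanSpace ℝ (Fin 3)} (hν : 0 < ν) (hT : 0 < T)
    (hu : IsLerayHopfOn T ν 0 u₀ u) :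
    ∃ w : ℝ → EuclideanSpace ℝ (Fin 3) → EuclideanSpace ℝ (Fin 3),
      IsGlobalLerayHopf ν 0 u₀ w ∧ ∀ t ∈ Icc 0 T, w t = u t := by
  have hmemT : MemLp (u T) 2 volume := hu.memLp T ⟨hT.le, le_rfl⟩
  have hdivT : IsWeaklyDivFree (u T) := hu.isWeaklyDivFree_final hT
  obtain ⟨w, hw⟩ := leray_existence_R3_holds ν hν (u T) hmemT hdivT
  refine ⟨fun t => if t ≤ T then u t else w (t - T), fun T' hT' => ?_, fun t ht => if_pos ht.2⟩
  exact (hu.concat hν.le hT hT' (hw T' hT')).of_le (by linarith)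

/-! ## §2 Gluing a classical representative behind a stage -/

namespace Stage

variable {ν : ℝ} {R : TowerRates} {S : Schedule R} {m : Margins R} {k : ℕ}

/-- **The gluing step.** Quiet schedule, `ν > 0`, stage `s` at level `k ≥ 2` (so the force is
silent on `[τ 1, ∞)` and `τ 1 < τ k`). Let `W` be Leray–Hopf (unforced) on `[0, T_W)` from `w₀`
with `W σ = s.u (σ + τ 1)` for `σ ∈ [0, τ k - τ 1]`, and let `(V, P)` be classical (unforced) on
the time set `[0, b)` with `V σ = s.u (σ + τ 1)` for `σ ∈ [0, τ k - τ 1)` and `W σ = V σ` a.e.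
for `σ ∈ [0, T' - τ 1]`, where `τ k ≤ T'`, `T' - τ 1 < b`, `T' - τ 1 ≤ T_W`. Then `s` has a
classical continuation `(u, p)` on `[0, T']` with the schedule's force, agreeing with `s` in
velocity and pressure on `[0, τ k]`, with finite energy on `[0, T']`, and with
`u t = V (t - τ 1)` on `[τ k, T']`. (Glue `s` on `[0, τ k)` with `(V, P)(· - τ 1)` along the
overlap `(τ 1, τ k)` — `IsClassicalNSSolutionOn.glue`, pressures normalised at `x = 0` — then add
back the stage's gauge `t ↦ s.p t 0`, extended smoothly past `τ k` (Seeley); at `t = τ k` the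
velocities agree because both are a.e. equal to `W (τ k - τ 1)` and continuous, the pressures by
`pressure_gauge_eq_of_velocity_eq`; the energy after `τ k` is that of `W`, at most
`½‖s.u (τ 1)‖²`.) [folklore] -/
theorem exists_continuation_of_rep (hν : 0 < ν) (hQ : S.Quiet) (hk : 2 ≤ k)
    (s : Stage ν R S m k)
    {W V : ℝ → EuclideanSpace ℝ (Fin 3) → EuclideanSpace ℝ (Fin 3)}
    {P : ℝ → EuclideanSpace ℝ (Fin 3) → ℝ} {w₀ : EuclideanSpace ℝ (Fin 3) → EuclideanSpace ℝ (Fin 3)}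
    {TW b T' : ℝ} (hW : IsLerayHopfOn TW ν 0 w₀ W)
    (hWs : ∀ σ ∈ Icc 0 (S.τ k - S.τ 1), W σ = s.u (σ + S.τ 1))
    (hV : IsClassicalNSSolutionOn (Ico 0 b) ν 0 V P)
    (hVs : ∀ σ ∈ Ico 0 (S.τ k - S.τ 1), V σ = s.u (σ + S.τ 1))
    (hrep : ∀ σ ∈ Icc 0 (T' - S.τ 1), W σ =ᵐ[volume] V σ)
    (hT'k : S.τ k ≤ T') (hT'b : T' - S.τ 1 < b) (hT'W : T' - S.τ 1 ≤ TW) :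
    ∃ (u : ℝ → EuclideanSpace ℝ (Fin 3) → EuclideanSpace ℝ (Fin 3))
      (p : ℝ → EuclideanSpace ℝ (Fin 3) → ℝ),
      IsClassicalNSSolutionOn (Icc 0 T') ν S.f u p ∧
      (∀ t ∈ Icc 0 (S.τ k), u t = s.u t ∧ p t = s.p t) ∧
      (∃ C : ℝ≥0∞, C < ⊤ ∧ ∀ t ∈ Icc 0 T', ∫⁻ x, ‖u t x‖ₑ ^ 2 ≤ C) ∧
      ∀ t ∈ Icc (S.τ k) T', u t = V (t - S.τ 1) := by
  have h1k : S.τ 1 < S.τ k := S.τ_strictMono (by omega : 1 < k)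
  set τ₁ : ℝ := S.τ 1 with hτ₁
  set τk : ℝ := S.τ k with hτk
  set L : ℝ := τk - τ₁ with hL
  have hL0 : 0 < L := by rw [hL]; linarith
  have hτ₁0 : 0 ≤ τ₁ := (S.τ_pos 1).le
  have hτk0 : 0 < τk := S.τ_pos k
  have hT'0 : 0 < T' := hτk0.trans_le hT'k
  have hLT' : L ≤ T' - τ₁ := by rw [hL]; linarith
  have hLb : L < b := hLT'.trans_lt hT'b
  have hτkb : τk ≤ τ₁ + b := by rw [hL] at hLb; linarith
  have hT'lt : T' < τ₁ + b := by linarith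
  -- the stage, translated to the time origin `τ₁`: unforced, classical on `[0, L]`
  have hwcl : IsClassicalNSSolutionOn (Icc 0 L) ν 0 (fun σ => s.u (σ + τ₁))
      (fun σ => s.p (σ + τ₁)) :=
    isClassicalNSSolutionOn_translate_of_silent s.classical hτ₁0 h1k hQ
  -- (V, P) restricted to the closed `[0, L]`
  have hVcl : IsClassicalNSSolutionOn (Icc 0 L) ν 0 V P :=
    hV.mono (Icc_subset_Ico_right hLb) (uniqueDiffOn_Icc hL0)
  -- velocity agreement at the endpoint `L` (both a.e. equal to `W L`, continuous slices)
  have hLmem : L ∈ Icc 0 (T' - τ₁) := ⟨hL0.le, hLT'⟩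
  have hVL : V L = s.u τk := by
    have hae : W L =ᵐ[volume] V L := hrep L hLmem
    rw [hWs L ⟨hL0.le, le_rfl⟩] at hae
    have hLk : L + τ₁ = τk := by rw [hL]; ring
    rw [hLk] at hae
    exact ((Continuous.ae_eq_iff_eq volume
      (s.classical.contDiff_velocity ⟨hτk0.le, le_rfl⟩).continuous
      (hV.contDiff_velocity ⟨hL0.le, hLb⟩).continuous).1 hae).symm
  have hVs' : ∀ σ ∈ Icc 0 L, V σ = s.u (σ + τ₁) := by
    intro σ hσ
    rcases hσ.2.lt_or_eq with hlt | heq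
    · exact hVs σ ⟨hσ.1, hlt⟩
    · rw [heq, hVL]
      congr 1
      rw [hL]; ring
  -- the pressure gauges agree on `[0, L]`
  have hgauge : ∀ σ ∈ Icc 0 L, ∀ x, s.p (σ + τ₁) x - s.p (σ + τ₁) 0 = P σ x - P σ 0 :=
    pressure_gauge_eq_of_velocity_eq hL0 le_rfl hwcl hVcl hVs'
  -- the right piece `(V, P)(· - τ₁)` on `(τ₁, τ₁ + b)`, with the schedule's (silent) force
  have hright : IsClassicalNSSolutionOn (Ioo τ₁ (τ₁ + b)) ν S.f (fun t => V (t + -τ₁))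
      (fun t => P (t + -τ₁)) := by
    have h := hV.comp_add_right (-τ₁)
    have h0 : (fun t => (0 : ℝ → EuclideanSpace ℝ (Fin 3) → EuclideanSpace ℝ (Fin 3)) (t + -τ₁))
        = 0 := rfl
    rw [h0] at h
    have h' : IsClassicalNSSolutionOn (Ioo τ₁ (τ₁ + b)) ν 0 (fun t => V (t + -τ₁))
        (fun t => P (t + -τ₁)) :=
      h.mono (fun t ht => ⟨by simp only [mem_Ioo] at ht; linarith [ht.1],
        by simp only [mem_Ioo] at ht; linarith [ht.2]⟩) (uniqueDiffOn_Ioo _ _)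
    exact h'.congr_force fun t ht x => (hQ.apply ht.1.le x).symm
  -- the left piece: the stage on `[0, τk)`
  have hleft : IsClassicalNSSolutionOn (Ico 0 τk) ν S.f s.u s.p :=
    s.classical.mono Ico_subset_Icc_self (uniqueDiffOn_Ico _ _)
  -- glue along the overlap `(τ₁, τk)`
  have hov : ∀ t ∈ Ioo τ₁ τk, s.u t = V (t + -τ₁) := by
    intro t ht
    have hσ : t + -τ₁ ∈ Ico 0 L := ⟨by linarith [ht.1], by rw [hL]; linarith [ht.2]⟩
    rw [hVs (t + -τ₁) hσ]
    congr 1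
    ring
  have hglue := hleft.glue hright hτ₁0 h1k hτkb hov
  have hglue' := hglue.mono (Icc_subset_Ico_right hT'lt) (uniqueDiffOn_Icc hT'0)
  -- the stage's pressure gauge `t ↦ s.p t 0`, smooth on `[0, τk]`, extended past `τk`
  have hc_smooth : ContDiffOn ℝ ∞ (fun t => s.p t 0) (Icc 0 τk) := by
    have hc : ContDiff ℝ ∞ (fun t : ℝ => ((t, (0 : EuclideanSpace ℝ (Fin 3))) :
        ℝ × EuclideanSpace ℝ (Fin 3))) := contDiff_id.prodMk contDiff_const
    exact s.classical.smooth_pressure.comp hc.contDiffOn (fun t ht => mk_mem_prod ht (mem_univ _))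
  obtain ⟨e, he, hec⟩ := exists_contDiffOn_Ici_extension hτk0 hc_smooth
  -- the re-gauged continuation
  set U : ℝ → EuclideanSpace ℝ (Fin 3) → EuclideanSpace ℝ (Fin 3) :=
    fun t => if t < τk then s.u t else V (t + -τ₁) with hU
  set Pg : ℝ → EuclideanSpace ℝ (Fin 3) → ℝ :=
    fun t => if t < τk then (fun x => s.p t x - s.p t 0) else fun x => P (t + -τ₁) x - P (t + -τ₁) 0
    with hPg
  set Pr : ℝ → EuclideanSpace ℝ (Fin 3) → ℝ := fun t x => Pg t x - (-e t) with hPr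
  have hcl : IsClassicalNSSolutionOn (Icc 0 T') ν S.f U Pr := by
    refine ⟨hglue'.smooth_velocity, ?_, ?_, hglue'.divFree⟩
    · have he' : ContDiffOn ℝ ∞ (fun z : ℝ × EuclideanSpace ℝ (Fin 3) => -e z.1)
          (Icc 0 T' ×ˢ univ) :=
        (he.comp contDiff_fst.contDiffOn (fun z hz => (hz.1 : z.1 ∈ Icc 0 T').1)).neg
      exact ContDiffOn.sub hglue'.smooth_pressure he'
    · intro t ht x
      have hg : gradient (Pr t) x = gradient (Pg t) x := gradient_sub_const (Pg t) (-e t) x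
      rw [hg]
      exact hglue'.momentum t ht x
  -- velocity on `[τk, T']`
  have hUV : ∀ t ∈ Icc τk T', U t = V (t - τ₁) := by
    intro t ht
    have hnot : ¬ t < τk := not_lt.2 ht.1
    simp only [hU, if_neg hnot, ← sub_eq_add_neg]
  -- agreement with the stage on `[0, τk]`
  have hagree : ∀ t ∈ Icc 0 τk, U t = s.u t ∧ Pr t = s.p t := by
    intro t ht
    rcases ht.2.lt_or_eq with hlt | heq
    · refine ⟨by simp only [hU, if_pos hlt], funext fun x => ?_⟩
      have h2 : e t = s.p t 0 := hec ht
      simp only [hPr, hPg, if_pos hlt, h2]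
      ring
    · rw [heq]
      refine ⟨?_, funext fun x => ?_⟩
      · rw [hUV _ ⟨le_rfl, hT'k⟩, ← hVL]
      · have h2 : e τk = s.p τk 0 := hec ⟨hτk0.le, le_rfl⟩
        have h3 := hgauge L ⟨hL0.le, le_rfl⟩ x
        have hLk : L + τ₁ = τk := by rw [hL]; ring
        rw [hLk] at h3
        have hLk' : τk + -τ₁ = L := by rw [hL]; ring
        show (if τk < τk then (fun x => s.p τk x - s.p τk 0)
            else fun x => P (τk + -τ₁) x - P (τk + -τ₁) 0) x - (-e τk) = s.p τk x
        rw [if_neg (lt_irrefl _), hLk', h2]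
        linarith
  -- finite energy on `[0, T']`: the stage's before `τk`, the Leray–Hopf field's after
  obtain ⟨C₁, hC₁, hE₁⟩ := s.energy
  have henergy : ∃ C : ℝ≥0∞, C < ⊤ ∧ ∀ t ∈ Icc 0 T', ∫⁻ x, ‖U t x‖ₑ ^ 2 ≤ C := by
    refine ⟨max C₁ (ENNReal.ofReal (2 * VectorCalculus.kineticEnergy w₀)),
      max_lt hC₁ ENNReal.ofReal_lt_top, fun t ht => ?_⟩
    by_cases hlt : t < τk
    · simp only [hU, if_pos hlt]
      exact (hE₁ t ⟨ht.1, hlt.le⟩).trans (le_max_left _ _)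
    · push Not at hlt
      have hσ : t + -τ₁ ∈ Icc 0 (T' - τ₁) := ⟨by linarith, by linarith [ht.2]⟩
      have hσW : t + -τ₁ ∈ Icc 0 TW := ⟨hσ.1, hσ.2.trans hT'W⟩
      have hae : W (t + -τ₁) =ᵐ[volume] V (t + -τ₁) := hrep _ hσ
      simp only [hU, if_neg (not_lt.2 hlt)]
      have h1 : ∫⁻ x, ‖V (t + -τ₁) x‖ₑ ^ 2 = ∫⁻ x, ‖W (t + -τ₁) x‖ₑ ^ 2 :=
        lintegral_congr_ae (by filter_upwards [hae] with x hx; rw [hx])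
      rw [h1]
      refine le_trans ?_ (le_max_right _ _)
      have h2 : ∫⁻ x, ‖W (t + -τ₁) x‖ₑ ^ 2 =
          ENNReal.ofReal (2 * VectorCalculus.kineticEnergy (W (t + -τ₁))) := hW.eEnergy_eq hσW
      rw [h2]
      exact ENNReal.ofReal_le_ofReal (mul_le_mul_of_nonneg_left
        (hW.kineticEnergy_le_of_zero_force hν.le hσW) (by norm_num))
  exact ⟨U, Pr, hcl, hagree, henergy, hUV⟩

/-! ## §3 A-priori continuation of a stage -/

/-- **A-priori continuation of a registered stage (quiet schedule, level `k ≥ 2`, any rates /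
margins / viscosity `ν > 0`).** If every finite-energy classical continuation of the stage `s`
on a slab `[0, T']`, `τ k ≤ T' ≤ T₁` (schedule's force; agreeing with `s` in velocity and pressure
on `[0, τ k]`), is bounded by `M` on `[τ k, T'] × ℝ³`, then `s` HAS a finite-energy classical
continuation on `[0, T₁]`. Existence is free; only the bound is a hypothesis. (`s.u (· + τ 1)` is
an unforced finite-energy classical solution on `[0, τ k - τ 1]`, hence Leray–Hopf — Tao 2013,
Lemma 8.1 — and extends to a global Leray–Hopf field `W` — Leray 1934; the a-priori continuation
of bounded classical representatives of `W`, `exists_classical_extension_of_apriori_bound`,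
applies: a candidate representative agrees with the stage before `τ k - τ 1`, where the stage's
ceiling `c₂ Y_k` bounds it, and glues to a continuation of `s` after, where `M` does.)
[cite: RobinsonRodrigoSadowski2016, Thm. 8.17] -/
theorem exists_continuation_of_apriori (hν : 0 < ν) (hQ : S.Quiet) (hk : 2 ≤ k)
    (s : Stage ν R S m k) {T₁ : ℝ} (hT₁ : S.τ k ≤ T₁) {M : ℝ}
    (hM : ∀ T' ∈ Icc (S.τ k) T₁,
      ∀ (u : ℝ → EuclideanSpace ℝ (Fin 3) → EuclideanSpace ℝ (Fin 3))
        (p : ℝ → EuclideanSpace ℝ (Fin 3) → ℝ),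
      IsClassicalNSSolutionOn (Icc 0 T') ν S.f u p →
      (∀ t ∈ Icc 0 (S.τ k), u t = s.u t ∧ p t = s.p t) →
      (∃ C : ℝ≥0∞, C < ⊤ ∧ ∀ t ∈ Icc 0 T', ∫⁻ x, ‖u t x‖ₑ ^ 2 ≤ C) →
      ∀ t ∈ Icc (S.τ k) T', ∀ x, ‖u t x‖ ≤ M) :
    ∃ (u : ℝ → EuclideanSpace ℝ (Fin 3) → EuclideanSpace ℝ (Fin 3))
      (p : ℝ → EuclideanSpace ℝ (Fin 3) → ℝ),
      IsClassicalNSSolutionOn (Icc 0 T₁) ν S.f u p ∧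
      (∀ t ∈ Icc 0 (S.τ k), u t = s.u t ∧ p t = s.p t) ∧
      (∃ C : ℝ≥0∞, C < ⊤ ∧ ∀ t ∈ Icc 0 T₁, ∫⁻ x, ‖u t x‖ₑ ^ 2 ≤ C) := by
  have h1k : S.τ 1 < S.τ k := S.τ_strictMono (by omega : 1 < k)
  set τ₁ : ℝ := S.τ 1 with hτ₁
  set τk : ℝ := S.τ k with hτk
  set L : ℝ := τk - τ₁ with hL
  set L₁ : ℝ := T₁ - τ₁ with hL₁
  have hL0 : 0 < L := by rw [hL]; linarith
  have hLL₁ : L ≤ L₁ := by rw [hL, hL₁]; linarith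
  have hL₁T : L₁ < L₁ + 1 := by linarith
  have hτ₁0 : 0 ≤ τ₁ := (S.τ_pos 1).le
  -- the stage translated to the origin `τ₁`: unforced, classical, finite energy ⇒ Leray–Hopf
  set w : ℝ → EuclideanSpace ℝ (Fin 3) → EuclideanSpace ℝ (Fin 3) := fun σ => s.u (σ + τ₁) with hw
  have hwcl : IsClassicalNSSolutionOn (Icc 0 L) ν 0 w (fun σ => s.p (σ + τ₁)) :=
    isClassicalNSSolutionOn_translate_of_silent s.classical hτ₁0 h1k hQ
  obtain ⟨C₁, hC₁, hE₁⟩ := s.energy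
  have hEw : ∃ C : ℝ≥0∞, C < ⊤ ∧ ∀ σ ∈ Icc 0 L, ∫⁻ x, ‖w σ x‖ₑ ^ 2 ≤ C :=
    ⟨C₁, hC₁, fun σ hσ => hE₁ (σ + τ₁) ⟨by linarith [hσ.1], by rw [hL] at hσ; linarith [hσ.2]⟩⟩
  have hLH : IsLerayHopfOn L ν 0 (w 0) w := (isLerayHopfOn_of_finiteEnergy hwcl hν hL0 hEw).1
  obtain ⟨W, hWg, hWw⟩ := exists_isGlobalLerayHopf_extension_Icc hν hL0 hLH
  have hWT : IsLerayHopfOn (L₁ + 1) ν 0 (w 0) W := hWg (L₁ + 1) (by linarith)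
  have hWs : ∀ σ ∈ Icc 0 (S.τ k - S.τ 1), W σ = s.u (σ + S.τ 1) := fun σ hσ => hWw σ hσ
  -- the initial representative: the translated stage on `[0, L)`
  have hV0 : IsClassicalNSSolutionOn (Ico 0 L) ν 0 w (fun σ => s.p (σ + τ₁)) :=
    hwcl.mono Ico_subset_Icc_self (uniqueDiffOn_Ico _ _)
  have hrep0 : ∀ σ ∈ Ico 0 L, W σ =ᵐ[volume] w σ := fun σ hσ => by
    rw [hWw σ (Ico_subset_Icc_self hσ)]
  -- the a-priori bound on candidate representatives: stage ceiling before `L`, `M` after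
  set M' : ℝ := max M (S.c₂ * R.Y k) with hM'
  have hMrep : ∀ β : ℝ, L ≤ β → β ≤ L₁ →
      ∀ (V' : ℝ → EuclideanSpace ℝ (Fin 3) → EuclideanSpace ℝ (Fin 3))
        (P' : ℝ → EuclideanSpace ℝ (Fin 3) → ℝ),
      IsClassicalNSSolutionOn (Ico 0 β) ν 0 V' P' → (∀ t ∈ Ico 0 L, V' t = w t) →
      (∀ t ∈ Ico 0 β, W t =ᵐ[volume] V' t) → ∀ t ∈ Ico 0 β, ∀ x, ‖V' t x‖ ≤ M' := by
    intro β hLβ hβL₁ V' P' hV' hV'w hV'rep σ hσ x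
    rcases lt_or_ge σ L with hσL | hσL
    · -- inside the stage: the level-`k` ceiling
      rw [hV'w σ ⟨hσ.1, hσL⟩]
      have hmem : σ + τ₁ ∈ Icc 0 (S.τ k) := ⟨by linarith [hσ.1], by rw [hL] at hσL; linarith⟩
      exact (s.ceiling k le_rfl (σ + τ₁) hmem x).trans (le_max_right _ _)
    · -- beyond the stage: glue and use the hypothesis on `[0, T']`, `T' = τ₁ + (σ + β)/2`
      set T' : ℝ := τ₁ + (σ + β) / 2 with hT'
      have hσβ : σ < β := hσ.2
      have hT'k : S.τ k ≤ T' := by rw [hT']; rw [hL] at hσL; linarith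
      have hT'b : T' - S.τ 1 < β := by rw [hT']; linarith
      have hT'W : T' - S.τ 1 ≤ L₁ + 1 := by rw [hT']; linarith
      have hT'T₁ : T' ≤ T₁ := by rw [hT']; rw [hL₁] at hβL₁; linarith
      have hrep' : ∀ σ' ∈ Icc 0 (T' - S.τ 1), W σ' =ᵐ[volume] V' σ' := fun σ' hσ' =>
        hV'rep σ' ⟨hσ'.1, hσ'.2.trans_lt hT'b⟩
      obtain ⟨u, p, hcl, hagree, henergy, huV⟩ :=
        s.exists_continuation_of_rep hν hQ hk hWT hWs hV' hV'w hrep' hT'k hT'b hT'W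
      have hσT' : σ + τ₁ ∈ Icc (S.τ k) T' :=
        ⟨by rw [hL] at hσL; linarith, by rw [hT']; linarith⟩
      have hb := hM T' ⟨hT'k, hT'T₁⟩ u p hcl hagree henergy (σ + τ₁) hσT' x
      rw [huV _ hσT', add_sub_cancel_right] at hb
      exact hb.trans (le_max_left _ _)
  obtain ⟨b, hb, V', P', hV', hV'w, hV'rep⟩ :=
    exists_classical_extension_of_apriori_bound hν hWT hL0 hLL₁ hL₁T hV0 hrep0 hMrep
  -- the continuation on `[0, T₁]`
  have hrep' : ∀ σ ∈ Icc 0 (T₁ - S.τ 1), W σ =ᵐ[volume] V' σ := fun σ hσ =>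
    hV'rep σ ⟨hσ.1, lt_min (hσ.2.trans_lt hb) (hσ.2.trans_lt hL₁T)⟩
  obtain ⟨u, p, hcl, hagree, henergy, -⟩ :=
    s.exists_continuation_of_rep hν hQ hk hWT hWs hV' hV'w hrep' hT₁ hb (le_of_lt hL₁T)
  exact ⟨u, p, hcl, hagree, henergy⟩

end Stage

/-! ## §4 The upper half from the a-priori ceiling, and conversely -/

/-- **`ContinuationEnvelope` from the a-priori ceiling.** If, for every pinned rigid quiet
schedule on the wide rates, every `k ≥ 2`, every registered stage `s` at level `k` and every
`T' ∈ [τ k, τ (k+1)]`, every finite-energy classical continuation of `s` on `[0, T']` stays inside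
the next ceiling `c₂ Y_{k+1}` on `[0, T']`, then `ContinuationEnvelope` holds: the continuation
to `τ (k+1)` EXISTS (`Stage.exists_continuation_of_apriori`) and is inside the ceiling by the
same hypothesis. [cite: RobinsonRodrigoSadowski2016, Thm. 8.17] -/
theorem continuationEnvelope_of_apriori
    (h : ∀ S : Schedule TowerRates.wide, S.Pins 8 (6 / 5) → S.Rigid → S.Quiet → ∀ k : ℕ, 2 ≤ k →
      ∀ s : Stage 1 TowerRates.wide S (Margins.routeG TowerRates.wide) k,
      ∀ T' ∈ Icc (S.τ k) (S.τ (k + 1)),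
      ∀ (u : ℝ → EuclideanSpace ℝ (Fin 3) → EuclideanSpace ℝ (Fin 3))
        (p : ℝ → EuclideanSpace ℝ (Fin 3) → ℝ),
        IsClassicalNSSolutionOn (Icc 0 T') 1 S.f u p →
        (∀ t ∈ Icc 0 (S.τ k), u t = s.u t ∧ p t = s.p t) →
        (∃ C : ℝ≥0∞, C < ⊤ ∧ ∀ t ∈ Icc 0 T', ∫⁻ x, ‖u t x‖ₑ ^ 2 ≤ C) →
        ∀ t ∈ Icc 0 T', ∀ x, ‖u t x‖ ≤ S.c₂ * TowerRates.wide.Y (k + 1)) :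
    ContinuationEnvelope := by
  intro S hP hR hQ k hk s
  have hkk : S.τ k ≤ S.τ (k + 1) := S.τ_mono (Nat.le_succ k)
  obtain ⟨u, p, hcl, hagree, henergy⟩ := s.exists_continuation_of_apriori one_pos hQ hk hkk
    (M := S.c₂ * TowerRates.wide.Y (k + 1))
    (fun T' hT' u p hcl hagree henergy t ht x =>
      h S hP hR hQ k hk s T' hT' u p hcl hagree henergy t ⟨(S.τ_pos k).le.trans ht.1, ht.2⟩ x)
  exact ⟨u, p, hcl, hagree, henergy, h S hP hR hQ k hk s _ ⟨hkk, le_rfl⟩ u p hcl hagree henergy⟩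

/-- **Conversely, `ContinuationEnvelope` gives the a-priori ceiling**: a finite-energy classical
continuation of a registered stage (`k ≥ 2`, quiet schedule) on `[0, T']`, `T' ≤ τ (k+1)`,
coincides there with the envelope's continuation (silent-window uniqueness,
`Stage.continuation_velocity_eq`, no named fact), which is inside the ceiling. [folklore] -/
theorem apriori_of_continuationEnvelope (h : ContinuationEnvelope) :
    ∀ S : Schedule TowerRates.wide, S.Pins 8 (6 / 5) → S.Rigid → S.Quiet → ∀ k : ℕ, 2 ≤ k →
      ∀ s : Stage 1 TowerRates.wide S (Margins.routeG TowerRates.wide) k,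
      ∀ T' ∈ Icc (S.τ k) (S.τ (k + 1)),
      ∀ (u : ℝ → EuclideanSpace ℝ (Fin 3) → EuclideanSpace ℝ (Fin 3))
        (p : ℝ → EuclideanSpace ℝ (Fin 3) → ℝ),
        IsClassicalNSSolutionOn (Icc 0 T') 1 S.f u p →
        (∀ t ∈ Icc 0 (S.τ k), u t = s.u t ∧ p t = s.p t) →
        (∃ C : ℝ≥0∞, C < ⊤ ∧ ∀ t ∈ Icc 0 T', ∫⁻ x, ‖u t x‖ₑ ^ 2 ≤ C) →
        ∀ t ∈ Icc 0 T', ∀ x, ‖u t x‖ ≤ S.c₂ * TowerRates.wide.Y (k + 1) := by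
  intro S hP hR hQ k hk s T' hT' u p hcl hagree henergy t ht x
  obtain ⟨u₁, p₁, hcl₁, hagree₁, henergy₁, hceil₁⟩ := h S hP hR hQ k hk s
  have hT'0 : 0 < T' := (S.τ_pos k).trans_le hT'.1
  have hcl₁' : IsClassicalNSSolutionOn (Icc 0 T') 1 S.f u₁ p₁ :=
    hcl₁.mono (Icc_subset_Icc le_rfl hT'.2) (uniqueDiffOn_Icc hT'0)
  have henergy₁' : ∃ C : ℝ≥0∞, C < ⊤ ∧ ∀ t ∈ Icc 0 T', ∫⁻ x, ‖u₁ t x‖ₑ ^ 2 ≤ C := by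
    obtain ⟨C, hC, hb⟩ := henergy₁
    exact ⟨C, hC, fun t ht => hb t ⟨ht.1, ht.2.trans hT'.2⟩⟩
  have heq : ∀ t ∈ Icc 0 T', u t = u₁ t :=
    s.continuation_velocity_eq one_pos hQ hk hT'.1 hcl hcl₁' (fun t ht => (hagree t ht).1)
      (fun t ht => (hagree₁ t ht).1) henergy henergy₁'
  rw [heq t ht]
  exact hceil₁ t ⟨ht.1, ht.2.trans hT'.2⟩ x

end Summit.NavierStokesRegularity.FluidComputer.PalasekTowerClayBridge

end
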